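import Summits.NavierStokesRegularity.OSWSelfSimilar.SheetREvenGardingLimit
import Summits.NavierStokesRegularity.OSWSelfSimilar.SheetRResolventBounds
import HarnessLib

/-!
# SHEET-ℝ frame, EVEN ZERO-MASS class `E⁺₀` — dictionary layer 5a: the defect form of the zero-mass weak equation, the pivot embedding of
# `EspE`, the PAIR GÅRDING INEQUALITY for weak solutions of the realified perturbed `σ`-system, pair UNIQUENESS and the sharp pivot bound

HONEST FRAMING (cell ns-blowup GROUP B / zone Z3, case Z3-SR-SPEC EVEN half; 1-D MODEL certificate frame (viscous gCLM/OSW sheet on the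
line); not Euler/NS; «violates: none — MODEL»).  Nothing here asserts that a profile exists; the (S1⁺) datum `GardingDataKE` is the HYPOTHESIS.

* `exists_defect` — DESIGN-Z3-SR-SPEC-EVEN (PO-1) in the kernel: if `p ∈ EspE` satisfies `linForm(u; φ) + ∫w(Kp)φ = ∫wgφ` on every ZERO-MASS
  even test, then for some constant `c_def` it satisfies `… = ∫wgφ + c_def·∫φ` on EVERY even test (`SheetREvenTests.eq_mass_mul_of_vanishes`);
* `ιEE : EspE L hL →L[ℝ] W L`, `p ↦ 2p₀` (`= profile p` a.e., `‖ιEE p‖² = ∫w(profile p)²`), and `ιpairE` on pairs;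
* `pair_gardingE` — for `(p_R, p_I)` solving, on zero-mass even tests, `linForm_{V+s}(u_R;φ) + ∫w(Kp_R)φ − t∫wu_Iφ = ∫wg_Rφ`,
  `linForm_{V+s}(u_I;φ) + ∫w(Kp_I)φ + t∫wu_Rφ = ∫wg_Iφ` (`(g_R, g_I) ∈ L²_w × L²_w`):
  **`c(‖u_R′‖²_w + ‖u_I′‖²_w) + (m + s)(‖u_R‖²_w + ‖u_I‖²_w) ≤ ∫wg_Ru_R + ∫wg_Iu_I`** (the `±t` cross terms cancel; two uses of
  `SheetREvenGardingLimit.garding_of_weakE`);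
* `pair_eq_zero_of_weakKE` — uniqueness (`G = 0`, `s > −m` ⇒ `(p_R, p_I) = 0`) and `pair_pivot_le` — `(m + s)‖ιpairE P‖ ≤ ‖G‖`.
Two bundled maps; no named fact.  WHAT THIS IS NOT: not NS.
-/

noncomputable section

namespace Summit.NavierStokesRegularity.OSWSelfSimilar
namespace SheetREvenPairUniqueness

open _root_.MeasureTheory _root_.Set _root_.Filter _root_.Real SheetRWeakProfilePV SheetRWeakToStrong SheetREnergyClass SheetRWeightedMeasure
  SheetRLinearisedTests SheetREnergySpace SheetRTestSpace SheetRLinearisedFormBounds SheetREvenTests SheetREvenEnergySpace SheetREvenForms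
  SheetREvenGardingLimit SheetRResolventBounds
open scoped Topology ENNReal

variable {L D₀ D₁ V₀ c m : ℝ} {d V : ℝ → ℝ}

/-! ### §1 The defect form of a zero-mass weak equation -/

/-- The weighted product of a weighted-`L²` FUNCTION with a parity-free test is integrable. [folklore] -/
theorem integrable_weight_fun_mul_any (hL : 0 < L) {g : ℝ → ℝ} (hgm : AEStronglyMeasurable g volume)
    (hg : Integrable fun y => (L ^ 2 + y ^ 2) * g y ^ 2) {v v₁ : ℝ → ℝ} (hv : IsCompactTestAny v v₁) :
    Integrable (fun y => (L ^ 2 + y ^ 2) * (g y * v y)) := by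
  obtain ⟨hc, -, -, -⟩ := basic_of_any hv
  obtain ⟨hi, -⟩ := integral_weight_abs_mul_le (L := L) hgm hc.aestronglyMeasurable hg (weighted_of_any (L := L) hv).1
  refine hi.mono' ((by fun_prop : AEStronglyMeasurable (fun y : ℝ => L ^ 2 + y ^ 2) volume).mul (hgm.mul hc.aestronglyMeasurable))
    (Eventually.of_forall fun y => ?_)
  rw [Real.norm_eq_abs, abs_mul, abs_of_nonneg (by positivity : (0:ℝ) ≤ L ^ 2 + y ^ 2)]

/-- **The defect form (DESIGN (PO-1)).**  If `p ∈ EspE` satisfies `linForm_V(profile p; φ) + ∫w(Kp)φ = ∫wgφ` for every ZERO-MASS even test,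
then there is `c_def` with `linForm_V(profile p; φ) + ∫w(Kp)φ = ∫wgφ + c_def·∫φ` for EVERY even test. [folklore] -/
theorem exists_defect (hL : 0 < L) (hdm : AEStronglyMeasurable d volume) (hVm : AEStronglyMeasurable V volume) (hD₁ : 0 ≤ D₁)
    (hd : ∀ ξ, |d ξ| ≤ D₀ + D₁ * |ξ|) (hV : ∀ ξ, |V ξ| ≤ V₀) {hL' : 0 < L} (K : EspE L hL' →L[ℝ] W L) (p : EspE L hL')
    {g : ℝ → ℝ} (hgm : AEStronglyMeasurable g volume) (hg : Integrable fun y => (L ^ 2 + y ^ 2) * g y ^ 2)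
    (hzero : ∀ φ φ₁ : ℝ → ℝ, IsCompactTestE φ φ₁ → ∫ y, φ y = 0 →
      linForm L d V (profile p) (derE p) φ φ₁ + ∫ y, (L ^ 2 + y ^ 2) * (((K p : W L) : ℝ → ℝ) y * φ y) =
        ∫ y, (L ^ 2 + y ^ 2) * (g y * φ y)) :
    ∃ cdef : ℝ, ∀ φ φ₁ : ℝ → ℝ, IsCompactTestE φ φ₁ →
      linForm L d V (profile p) (derE p) φ φ₁ + ∫ y, (L ^ 2 + y ^ 2) * (((K p : W L) : ℝ → ℝ) y * φ y) =
        (∫ y, (L ^ 2 + y ^ 2) * (g y * φ y)) + cdef * ∫ y, φ y := by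
  -- the defect functional `Λ(φ) = linForm(u; φ) + ∫w(Kp)φ − ∫wgφ` on the even tests
  have hI : ∀ vp : testSpaceE, Integrable (fun y => (L ^ 2 + y ^ 2) * (derE p y * vp.1.2 y) + 2 * y * (derE p y * vp.1.1 y)
      + (L ^ 2 + y ^ 2) * d y * (derE p y * vp.1.1 y) + (L ^ 2 + y ^ 2) * V y * (profile p y * vp.1.1 y)) := fun vp =>
    (abs_linForm_profileE_le hL hdm hVm hD₁ hd hV vp.2.toIsCompactTestAny p).1
  set Λ : testSpaceE →ₗ[ℝ] ℝ :=
    { toFun := fun vp => linForm L d V (profile p) (derE p) vp.1.1 vp.1.2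
        + (∫ y, (L ^ 2 + y ^ 2) * (((K p : W L) : ℝ → ℝ) y * vp.1.1 y)) - ∫ y, (L ^ 2 + y ^ 2) * (g y * vp.1.1 y)
      map_add' := by
        intro vp vq
        have e1 : linForm L d V (profile p) (derE p) (vp + vq).1.1 (vp + vq).1.2 =
            linForm L d V (profile p) (derE p) vp.1.1 vp.1.2 + linForm L d V (profile p) (derE p) vq.1.1 vq.1.2 :=
          linForm_add_right L d V (hI vp) (hI vq)
        have e2 : ∫ y, (L ^ 2 + y ^ 2) * (((K p : W L) : ℝ → ℝ) y * (vp + vq).1.1 y) =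
            (∫ y, (L ^ 2 + y ^ 2) * (((K p : W L) : ℝ → ℝ) y * vp.1.1 y)) + ∫ y, (L ^ 2 + y ^ 2) * (((K p : W L) : ℝ → ℝ) y * vq.1.1 y) := by
          rw [← integral_add (integrable_weight_mul_any hL (K p) vp.2.toIsCompactTestAny).1
            (integrable_weight_mul_any hL (K p) vq.2.toIsCompactTestAny).1]
          refine integral_congr_ae (Eventually.of_forall fun y => ?_)
          show (L ^ 2 + y ^ 2) * (((K p : W L) : ℝ → ℝ) y * (vp.1.1 y + vq.1.1 y)) = _
          ring
        have e3 : ∫ y, (L ^ 2 + y ^ 2) * (g y * (vp + vq).1.1 y) =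
            (∫ y, (L ^ 2 + y ^ 2) * (g y * vp.1.1 y)) + ∫ y, (L ^ 2 + y ^ 2) * (g y * vq.1.1 y) := by
          rw [← integral_add (integrable_weight_fun_mul_any hL hgm hg vp.2.toIsCompactTestAny)
            (integrable_weight_fun_mul_any hL hgm hg vq.2.toIsCompactTestAny)]
          refine integral_congr_ae (Eventually.of_forall fun y => ?_)
          show (L ^ 2 + y ^ 2) * (g y * (vp.1.1 y + vq.1.1 y)) = _
          ring
        rw [e1, e2, e3]; ring
      map_smul' := by
        intro a vp
        have e1 : linForm L d V (profile p) (derE p) (a • vp).1.1 (a • vp).1.2 = a * linForm L d V (profile p) (derE p) vp.1.1 vp.1.2 :=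
          linForm_smul_right L d V a
        have e2 : ∫ y, (L ^ 2 + y ^ 2) * (((K p : W L) : ℝ → ℝ) y * (a • vp).1.1 y) =
            a * ∫ y, (L ^ 2 + y ^ 2) * (((K p : W L) : ℝ → ℝ) y * vp.1.1 y) := by
          rw [← integral_const_mul]
          refine integral_congr_ae (Eventually.of_forall fun y => ?_)
          show (L ^ 2 + y ^ 2) * (((K p : W L) : ℝ → ℝ) y * (a * vp.1.1 y)) = _
          ring
        have e3 : ∫ y, (L ^ 2 + y ^ 2) * (g y * (a • vp).1.1 y) = a * ∫ y, (L ^ 2 + y ^ 2) * (g y * vp.1.1 y) := by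
          rw [← integral_const_mul]
          refine integral_congr_ae (Eventually.of_forall fun y => ?_)
          show (L ^ 2 + y ^ 2) * (g y * (a * vp.1.1 y)) = _
          ring
        rw [e1, e2, e3, RingHom.id_apply, smul_eq_mul]; ring } with hΛ
  have hvan : ∀ vp : testSpaceE, ∫ y, vp.1.1 y = 0 → Λ vp = 0 := by
    intro vp h0
    have := hzero vp.1.1 vp.1.2 vp.2 h0
    show linForm L d V (profile p) (derE p) vp.1.1 vp.1.2
        + (∫ y, (L ^ 2 + y ^ 2) * (((K p : W L) : ℝ → ℝ) y * vp.1.1 y)) - ∫ y, (L ^ 2 + y ^ 2) * (g y * vp.1.1 y) = 0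
    linarith
  refine ⟨Λ bump, fun φ φ₁ hφ => ?_⟩
  have h := eq_mass_mul_of_vanishes Λ hvan ⟨(φ, φ₁), hφ⟩
  have hval : Λ ⟨(φ, φ₁), hφ⟩ = linForm L d V (profile p) (derE p) φ φ₁
      + (∫ y, (L ^ 2 + y ^ 2) * (((K p : W L) : ℝ → ℝ) y * φ y)) - ∫ y, (L ^ 2 + y ^ 2) * (g y * φ y) := rfl
  rw [hval] at h
  have : (∫ y, φ y) * Λ bump = Λ bump * ∫ y, φ y := mul_comm _ _
  linarith

/-! ### §2 The pivot embedding of the even energy space -/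

/-- **Pivot embedding** `ιEE : EspE L hL →L[ℝ] W L`, `p ↦ 2·p₀` (`= profile p` a.e.). [folklore] -/
def ιEE (hL : 0 < L) : EspE L hL →L[ℝ] W L :=
  (2 : ℝ) • ((WithLp.fstL 2 ℝ (W L) (W L)).comp (EspE L hL).subtypeL)

/-- `ιEE p = 2·p₀`. [folklore] -/
theorem ιEE_apply (hL : 0 < L) (p : EspE L hL) : ιEE hL p = (2 : ℝ) • ((p : WithLp 2 (W L × W L)).fst : W L) := rfl

/-- `ιEE p = profile p` Lebesgue-a.e. [folklore] -/
theorem ιEE_ae (hL : 0 < L) (p : EspE L hL) : ((ιEE hL p : W L) : ℝ → ℝ) =ᵐ[volume] profile p := by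
  rw [ιEE_apply]
  filter_upwards [ae_volume_of_ae_μw hL (Lp.coeFn_smul (2 : ℝ) ((p : WithLp 2 (W L × W L)).fst : W L)), profile_ae_eq hL p]
    with y h1 h2
  rw [h1, Pi.smul_apply, smul_eq_mul, h2]

/-- `‖ιEE p‖ = 2‖p₀‖ = √∫w(profile p)² ≤ 2‖p‖`, and `‖ιEE p‖² = ∫w(profile p)²`. [folklore] -/
theorem norm_ιEE (hL : 0 < L) (p : EspE L hL) :
    ‖ιEE hL p‖ = Real.sqrt (∫ y, (L ^ 2 + y ^ 2) * profile p y ^ 2) ∧ ‖ιEE hL p‖ ≤ 2 * ‖p‖ ∧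
      ‖ιEE hL p‖ ^ 2 = ∫ y, (L ^ 2 + y ^ 2) * profile p y ^ 2 := by
  have hn : ‖ιEE hL p‖ = 2 * ‖((p : WithLp 2 (W L × W L)).fst : W L)‖ := by
    rw [ιEE_apply, norm_smul, Real.norm_eq_abs, abs_two]
  obtain ⟨-, -, -, -, -, e0, -, -⟩ := energyClassE_of_mem hL p
  obtain ⟨-, -, -, -, e0', -⟩ := profileE_facts hL p
  refine ⟨by rw [hn, e0'], ?_, by rw [hn, e0]; ring⟩
  rw [hn]
  exact mul_le_mul_of_nonneg_left (WithLp.norm_fst_le (x := (p : WithLp 2 (W L × W L)))) zero_le_two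

/-- **Pair pivot embedding** `(p_R, p_I) ↦ (ιEE p_R, ιEE p_I)`. [folklore] -/
def ιpairE (hL : 0 < L) : WithLp 2 (EspE L hL × EspE L hL) →L[ℝ] WithLp 2 (W L × W L) :=
  ((WithLp.prodContinuousLinearEquiv 2 ℝ (W L) (W L)).symm : (W L × W L) →L[ℝ] WithLp 2 (W L × W L)).comp
    (((ιEE hL).comp (WithLp.fstL 2 ℝ (EspE L hL) (EspE L hL))).prod ((ιEE hL).comp (WithLp.sndL 2 ℝ (EspE L hL) (EspE L hL))))

/-- Components of `ιpairE`. [folklore] -/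
theorem ιpairE_fst_snd (hL : 0 < L) (P : WithLp 2 (EspE L hL × EspE L hL)) :
    (ιpairE hL P).fst = ιEE hL P.fst ∧ (ιpairE hL P).snd = ιEE hL P.snd := ⟨rfl, rfl⟩

/-- `‖ιpairE P‖² = ∫w(profile P_R)² + ∫w(profile P_I)²` and `‖ιpairE P‖ ≤ 2‖P‖`. [folklore] -/
theorem norm_ιpairE (hL : 0 < L) (P : WithLp 2 (EspE L hL × EspE L hL)) :
    ‖ιpairE hL P‖ ^ 2 = (∫ y, (L ^ 2 + y ^ 2) * profile P.fst y ^ 2) + ∫ y, (L ^ 2 + y ^ 2) * profile P.snd y ^ 2 ∧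
      ‖ιpairE hL P‖ ≤ 2 * ‖P‖ := by
  obtain ⟨h1, h2⟩ := ιpairE_fst_snd hL P
  obtain ⟨-, bR, eR⟩ := norm_ιEE hL P.fst
  obtain ⟨-, bI, eI⟩ := norm_ιEE hL P.snd
  have hsq : ‖ιpairE hL P‖ ^ 2 = ‖ιEE hL P.fst‖ ^ 2 + ‖ιEE hL P.snd‖ ^ 2 := by rw [WithLp.prod_norm_sq_eq_of_L2, h1, h2]
  refine ⟨by rw [hsq, eR, eI], ?_⟩
  have hsq' : ‖ιpairE hL P‖ ^ 2 ≤ (2 * ‖P‖) ^ 2 := by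
    rw [hsq, mul_pow, WithLp.prod_norm_sq_eq_of_L2]
    nlinarith [bR, bI, norm_nonneg (ιEE hL P.fst), norm_nonneg (ιEE hL P.snd)]
  nlinarith [hsq', norm_nonneg (ιpairE hL P), norm_nonneg P]

/-! ### §3 The pair Gårding inequality and its consequences -/

section Pair

variable {hL : 0 < L} {K : EspE L hL →L[ℝ] W L}

/-- **PAIR GÅRDING INEQUALITY.**  For `(p_R, p_I)` solving the realified shifted perturbed `σ = s + it` system on zero-mass even tests with
data `(g_R, g_I) ∈ L²_w × L²_w`: `c(∫w u_R′² + ∫w u_I′²) + (m + s)(∫w u_R² + ∫w u_I²) ≤ ∫wg_Ru_R + ∫wg_Iu_I`. [folklore] -/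
theorem pair_gardingE (h : GardingDataKE L hL d V K D₀ D₁ V₀ c m) (s t : ℝ) (P : WithLp 2 (EspE L hL × EspE L hL))
    (G : WithLp 2 (W L × W L))
    (hweak : ∀ v v₁ : ℝ → ℝ, IsCompactTestE v v₁ → ∫ y, v y = 0 →
      linForm L d (fun ξ => V ξ + s) (profile P.fst) (derE P.fst) v v₁
            + (∫ y, (L ^ 2 + y ^ 2) * (((K P.fst : W L) : ℝ → ℝ) y * v y))
            - t * ∫ y, (L ^ 2 + y ^ 2) * (profile P.snd y * v y) = ∫ y, (L ^ 2 + y ^ 2) * (((G.fst : W L) : ℝ → ℝ) y * v y) ∧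
        linForm L d (fun ξ => V ξ + s) (profile P.snd) (derE P.snd) v v₁
            + (∫ y, (L ^ 2 + y ^ 2) * (((K P.snd : W L) : ℝ → ℝ) y * v y))
            + t * ∫ y, (L ^ 2 + y ^ 2) * (profile P.fst y * v y) = ∫ y, (L ^ 2 + y ^ 2) * (((G.snd : W L) : ℝ → ℝ) y * v y)) :
    c * ((∫ y, (L ^ 2 + y ^ 2) * derE P.fst y ^ 2) + ∫ y, (L ^ 2 + y ^ 2) * derE P.snd y ^ 2)
        + (m + s) * ((∫ y, (L ^ 2 + y ^ 2) * profile P.fst y ^ 2) + ∫ y, (L ^ 2 + y ^ 2) * profile P.snd y ^ 2) ≤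
      (∫ y, (L ^ 2 + y ^ 2) * (((G.fst : W L) : ℝ → ℝ) y * profile P.fst y))
        + ∫ y, (L ^ 2 + y ^ 2) * (((G.snd : W L) : ℝ → ℝ) y * profile P.snd y) := by
  obtain ⟨hVsm, hVs⟩ := shift_hypsE h s
  obtain ⟨humR, hu₁mR, h0R, h1R, -, -⟩ := profileE_facts hL P.fst
  obtain ⟨humI, hu₁mI, h0I, h1I, -, -⟩ := profileE_facts hL P.snd
  have hgRm : AEStronglyMeasurable ((G.fst : W L) : ℝ → ℝ) volume := aestronglyMeasurable_of_W hL _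
  have hgIm : AEStronglyMeasurable ((G.snd : W L) : ℝ → ℝ) volume := aestronglyMeasurable_of_W hL _
  have hgR := weightedSq_of_W hL (G.fst : W L)
  have hgI := weightedSq_of_W hL (G.snd : W L)
  -- the combined data `g_R + t u_I`, `g_I − t u_R`
  have hw2 : ∀ {f g : ℝ → ℝ}, AEStronglyMeasurable f volume → AEStronglyMeasurable g volume →
      Integrable (fun y => (L ^ 2 + y ^ 2) * f y ^ 2) → Integrable (fun y => (L ^ 2 + y ^ 2) * g y ^ 2) → ∀ a : ℝ,
      Integrable (fun y => (L ^ 2 + y ^ 2) * (f y + a * g y) ^ 2) := by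
    intro f g hf hg hfi hgi a
    refine (((hfi.const_mul 2).add ((hgi.const_mul (2 * a ^ 2)))).mono'
      ((by fun_prop : AEStronglyMeasurable (fun y : ℝ => L ^ 2 + y ^ 2) volume).mul ((hf.add (hg.const_mul a)).pow 2))
      (Eventually.of_forall fun y => ?_))
    rw [Real.norm_eq_abs, abs_of_nonneg (by positivity)]
    simp only [Pi.add_apply]
    have hw : 0 ≤ L ^ 2 + y ^ 2 := by positivity
    nlinarith [mul_nonneg hw (sq_nonneg (f y - a * g y))]
  have hdR := hw2 hgRm humI hgR h0I t
  have hdI := hw2 hgIm humR hgI h0R (-t)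
  -- zero-mass weak equations with the combined data
  have hzR : ∀ φ φ₁ : ℝ → ℝ, IsCompactTestE φ φ₁ → ∫ y, φ y = 0 →
      linForm L d (fun ξ => V ξ + s) (profile P.fst) (derE P.fst) φ φ₁ + ∫ y, (L ^ 2 + y ^ 2) * (((K P.fst : W L) : ℝ → ℝ) y * φ y) =
        ∫ y, (L ^ 2 + y ^ 2) * ((((G.fst : W L) : ℝ → ℝ) y + t * profile P.snd y) * φ y) := by
    intro φ φ₁ hφ h0
    obtain ⟨e1, -⟩ := hweak φ φ₁ hφ h0
    have hsum : ∫ y, (L ^ 2 + y ^ 2) * ((((G.fst : W L) : ℝ → ℝ) y + t * profile P.snd y) * φ y) =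
        (∫ y, (L ^ 2 + y ^ 2) * (((G.fst : W L) : ℝ → ℝ) y * φ y)) + t * ∫ y, (L ^ 2 + y ^ 2) * (profile P.snd y * φ y) := by
      rw [← integral_const_mul, ← integral_add (integrable_weight_mul_any hL (G.fst : W L) hφ.toIsCompactTestAny).1
        ((integrable_weight_fun_mul_any hL humI h0I hφ.toIsCompactTestAny).const_mul t)]
      refine integral_congr_ae (Eventually.of_forall fun y => ?_)
      ring
    rw [hsum]; linarith
  have hzI : ∀ φ φ₁ : ℝ → ℝ, IsCompactTestE φ φ₁ → ∫ y, φ y = 0 →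
      linForm L d (fun ξ => V ξ + s) (profile P.snd) (derE P.snd) φ φ₁ + ∫ y, (L ^ 2 + y ^ 2) * (((K P.snd : W L) : ℝ → ℝ) y * φ y) =
        ∫ y, (L ^ 2 + y ^ 2) * ((((G.snd : W L) : ℝ → ℝ) y + -t * profile P.fst y) * φ y) := by
    intro φ φ₁ hφ h0
    obtain ⟨-, e2⟩ := hweak φ φ₁ hφ h0
    have hsum : ∫ y, (L ^ 2 + y ^ 2) * ((((G.snd : W L) : ℝ → ℝ) y + -t * profile P.fst y) * φ y) =
        (∫ y, (L ^ 2 + y ^ 2) * (((G.snd : W L) : ℝ → ℝ) y * φ y)) + -t * ∫ y, (L ^ 2 + y ^ 2) * (profile P.fst y * φ y) := by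
      rw [← integral_const_mul, ← integral_add (integrable_weight_mul_any hL (G.snd : W L) hφ.toIsCompactTestAny).1
        ((integrable_weight_fun_mul_any hL humR h0R hφ.toIsCompactTestAny).const_mul (-t))]
      refine integral_congr_ae (Eventually.of_forall fun y => ?_)
      ring
    rw [hsum]; linarith
  -- defect forms on all even tests
  have hgR'm : AEStronglyMeasurable (fun y => ((G.fst : W L) : ℝ → ℝ) y + t * profile P.snd y) volume := hgRm.add (humI.const_mul t)
  have hgI'm : AEStronglyMeasurable (fun y => ((G.snd : W L) : ℝ → ℝ) y + -t * profile P.fst y) volume :=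
    hgIm.add (humR.const_mul (-t))
  obtain ⟨cR, hR⟩ := exists_defect hL h.d_meas hVsm h.D₁_nonneg h.d_le hVs K P.fst hgR'm hdR hzR
  obtain ⟨cI, hI⟩ := exists_defect hL h.d_meas hVsm h.D₁_nonneg h.d_le hVs K P.snd hgI'm hdI hzI
  -- the master inequality, twice
  have hMR := garding_of_weakE h s P.fst hgR'm hdR cR hR
  have hMI := garding_of_weakE h s P.snd hgI'm hdI cI hI
  -- split the data pairings; the cross terms cancel
  obtain ⟨hiR, -⟩ := integral_weight_abs_mul_le (L := L) hgRm humR hgR h0R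
  obtain ⟨hiI, -⟩ := integral_weight_abs_mul_le (L := L) hgIm humI hgI h0I
  obtain ⟨hiX, -⟩ := integral_weight_abs_mul_le (L := L) humI humR h0I h0R
  have key : ∀ {f g : ℝ → ℝ}, AEStronglyMeasurable f volume → AEStronglyMeasurable g volume →
      Integrable (fun y => (L ^ 2 + y ^ 2) * |f y * g y|) → Integrable (fun y => (L ^ 2 + y ^ 2) * (f y * g y)) := by
    intro f g hf hg hi
    refine hi.mono' ((by fun_prop : AEStronglyMeasurable (fun y : ℝ => L ^ 2 + y ^ 2) volume).mul (hf.mul hg))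
      (Eventually.of_forall fun y => ?_)
    rw [Real.norm_eq_abs, abs_mul, abs_of_nonneg (by positivity : (0:ℝ) ≤ L ^ 2 + y ^ 2)]
  have jR := key hgRm humR hiR
  have jI := key hgIm humI hiI
  have jX := key humI humR hiX
  have eR : ∫ y, (L ^ 2 + y ^ 2) * ((((G.fst : W L) : ℝ → ℝ) y + t * profile P.snd y) * profile P.fst y) =
      (∫ y, (L ^ 2 + y ^ 2) * (((G.fst : W L) : ℝ → ℝ) y * profile P.fst y)) + t * ∫ y, (L ^ 2 + y ^ 2) * (profile P.snd y * profile P.fst y) := by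
    rw [← integral_const_mul, ← integral_add jR (jX.const_mul t)]
    refine integral_congr_ae (Eventually.of_forall fun y => ?_)
    ring
  have eI : ∫ y, (L ^ 2 + y ^ 2) * ((((G.snd : W L) : ℝ → ℝ) y + -t * profile P.fst y) * profile P.snd y) =
      (∫ y, (L ^ 2 + y ^ 2) * (((G.snd : W L) : ℝ → ℝ) y * profile P.snd y)) + -t * ∫ y, (L ^ 2 + y ^ 2) * (profile P.snd y * profile P.fst y) := by
    rw [← integral_const_mul, ← integral_add jI (jX.const_mul (-t))]
    refine integral_congr_ae (Eventually.of_forall fun y => ?_)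
    ring
  rw [eR] at hMR
  rw [eI] at hMI
  linarith

/-- **Uniqueness for the realified perturbed `σ`-system** (`s > −m`): zero data on zero-mass even tests ⇒ `(p_R, p_I) = 0`. [folklore] -/
theorem pair_eq_zero_of_weakKE (h : GardingDataKE L hL d V K D₀ D₁ V₀ c m) {s : ℝ} (hs : -m < s) (t : ℝ)
    (P : WithLp 2 (EspE L hL × EspE L hL))
    (hweak : ∀ v v₁ : ℝ → ℝ, IsCompactTestE v v₁ → ∫ y, v y = 0 →
      linForm L d (fun ξ => V ξ + s) (profile P.fst) (derE P.fst) v v₁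
            + (∫ y, (L ^ 2 + y ^ 2) * (((K P.fst : W L) : ℝ → ℝ) y * v y))
            - t * ∫ y, (L ^ 2 + y ^ 2) * (profile P.snd y * v y) = 0 ∧
        linForm L d (fun ξ => V ξ + s) (profile P.snd) (derE P.snd) v v₁
            + (∫ y, (L ^ 2 + y ^ 2) * (((K P.snd : W L) : ℝ → ℝ) y * v y))
            + t * ∫ y, (L ^ 2 + y ^ 2) * (profile P.fst y * v y) = 0) :
    P = 0 := by
  have hw' : ∀ v v₁ : ℝ → ℝ, IsCompactTestE v v₁ → ∫ y, v y = 0 →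
      linForm L d (fun ξ => V ξ + s) (profile P.fst) (derE P.fst) v v₁
            + (∫ y, (L ^ 2 + y ^ 2) * (((K P.fst : W L) : ℝ → ℝ) y * v y))
            - t * ∫ y, (L ^ 2 + y ^ 2) * (profile P.snd y * v y) =
              ∫ y, (L ^ 2 + y ^ 2) * ((((0 : WithLp 2 (W L × W L)).fst : W L) : ℝ → ℝ) y * v y) ∧
        linForm L d (fun ξ => V ξ + s) (profile P.snd) (derE P.snd) v v₁
            + (∫ y, (L ^ 2 + y ^ 2) * (((K P.snd : W L) : ℝ → ℝ) y * v y))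
            + t * ∫ y, (L ^ 2 + y ^ 2) * (profile P.fst y * v y) =
              ∫ y, (L ^ 2 + y ^ 2) * ((((0 : WithLp 2 (W L × W L)).snd : W L) : ℝ → ℝ) y * v y) := by
    intro v v₁ hv h0
    have hz : ((((0 : WithLp 2 (W L × W L)).fst : W L) : ℝ → ℝ)) =ᵐ[volume] 0 := by
      rw [WithLp.zero_fst]; exact ae_volume_of_ae_μw hL (Lp.coeFn_zero _ _ _)
    have hz' : ((((0 : WithLp 2 (W L × W L)).snd : W L) : ℝ → ℝ)) =ᵐ[volume] 0 := by
      rw [WithLp.zero_snd]; exact ae_volume_of_ae_μw hL (Lp.coeFn_zero _ _ _)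
    have i1 : ∫ y, (L ^ 2 + y ^ 2) * ((((0 : WithLp 2 (W L × W L)).fst : W L) : ℝ → ℝ) y * v y) = 0 := by
      rw [integral_congr_ae (hz.mono fun y hy => by rw [hy])]; simp
    have i2 : ∫ y, (L ^ 2 + y ^ 2) * ((((0 : WithLp 2 (W L × W L)).snd : W L) : ℝ → ℝ) y * v y) = 0 := by
      rw [integral_congr_ae (hz'.mono fun y hy => by rw [hy])]; simp
    rw [i1, i2]; exact hweak v v₁ hv h0
  have hG := pair_gardingE h s t P 0 hw'
  have hz : ((((0 : WithLp 2 (W L × W L)).fst : W L) : ℝ → ℝ)) =ᵐ[volume] 0 := by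
    rw [WithLp.zero_fst]; exact ae_volume_of_ae_μw hL (Lp.coeFn_zero _ _ _)
  have hz' : ((((0 : WithLp 2 (W L × W L)).snd : W L) : ℝ → ℝ)) =ᵐ[volume] 0 := by
    rw [WithLp.zero_snd]; exact ae_volume_of_ae_μw hL (Lp.coeFn_zero _ _ _)
  have i1 : ∫ y, (L ^ 2 + y ^ 2) * ((((0 : WithLp 2 (W L × W L)).fst : W L) : ℝ → ℝ) y * profile P.fst y) = 0 := by
    rw [integral_congr_ae (hz.mono fun y hy => by rw [hy])]; simp
  have i2 : ∫ y, (L ^ 2 + y ^ 2) * ((((0 : WithLp 2 (W L × W L)).snd : W L) : ℝ → ℝ) y * profile P.snd y) = 0 := by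
    rw [integral_congr_ae (hz'.mono fun y hy => by rw [hy])]; simp
  rw [i1, i2, add_zero] at hG
  obtain ⟨-, -, -, -, -, e0R, e1R, -⟩ := energyClassE_of_mem hL P.fst
  obtain ⟨-, -, -, -, -, e0I, e1I, -⟩ := energyClassE_of_mem hL P.snd
  rw [derE_def, derE_def, e1R, e1I, e0R, e0I] at hG
  have hc := h.c_pos
  have hms : 0 < m + s := by linarith
  -- pure real-number step: nonnegative terms with positive weights summing to `≤ 0` vanish
  have key : ∀ {x y z w : ℝ}, 0 ≤ x → 0 ≤ y → 0 ≤ z → 0 ≤ w → c * (x + y) + (m + s) * (4 * z + 4 * w) ≤ 0 →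
      x = 0 ∧ y = 0 ∧ z = 0 ∧ w = 0 := by
    intro x y z w hx hy hz hw hle
    have px := mul_nonneg hc.le hx
    have py := mul_nonneg hc.le hy
    have pz := mul_nonneg hms.le hz
    have pw := mul_nonneg hms.le hw
    have ex : c * x = 0 := by linarith
    have ey : c * y = 0 := by linarith
    have ez : (m + s) * z = 0 := by linarith
    have ew : (m + s) * w = 0 := by linarith
    exact ⟨(mul_eq_zero.1 ex).resolve_left hc.ne', (mul_eq_zero.1 ey).resolve_left hc.ne',
      (mul_eq_zero.1 ez).resolve_left hms.ne', (mul_eq_zero.1 ew).resolve_left hms.ne'⟩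
  obtain ⟨x0, y0, z0, w0⟩ := key (sq_nonneg _) (sq_nonneg _) (sq_nonneg _) (sq_nonneg _) hG
  have hR : ‖(P.fst : WithLp 2 (W L × W L))‖ ^ 2 = 0 := by
    rw [WithLp.prod_norm_sq_eq_of_L2, z0, x0, add_zero]
  have hI : ‖(P.snd : WithLp 2 (W L × W L))‖ ^ 2 = 0 := by
    rw [WithLp.prod_norm_sq_eq_of_L2, w0, y0, add_zero]
  have hf : P.fst = 0 := Subtype.ext (norm_eq_zero.1 (pow_eq_zero_iff two_ne_zero |>.1 hR))
  have hs' : P.snd = 0 := Subtype.ext (norm_eq_zero.1 (pow_eq_zero_iff two_ne_zero |>.1 hI))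
  exact WithLp.ofLp_injective 2 (Prod.ext hf hs')

/-- **The sharp pivot bound for the pair**: `(m + s)·‖ιpairE P‖ ≤ ‖G‖` (`s > −m`). [folklore] -/
theorem pair_pivot_le (h : GardingDataKE L hL d V K D₀ D₁ V₀ c m) {s : ℝ} (hs : -m < s) (t : ℝ) (P : WithLp 2 (EspE L hL × EspE L hL))
    (G : WithLp 2 (W L × W L))
    (hweak : ∀ v v₁ : ℝ → ℝ, IsCompactTestE v v₁ → ∫ y, v y = 0 →
      linForm L d (fun ξ => V ξ + s) (profile P.fst) (derE P.fst) v v₁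
            + (∫ y, (L ^ 2 + y ^ 2) * (((K P.fst : W L) : ℝ → ℝ) y * v y))
            - t * ∫ y, (L ^ 2 + y ^ 2) * (profile P.snd y * v y) = ∫ y, (L ^ 2 + y ^ 2) * (((G.fst : W L) : ℝ → ℝ) y * v y) ∧
        linForm L d (fun ξ => V ξ + s) (profile P.snd) (derE P.snd) v v₁
            + (∫ y, (L ^ 2 + y ^ 2) * (((K P.snd : W L) : ℝ → ℝ) y * v y))
            + t * ∫ y, (L ^ 2 + y ^ 2) * (profile P.fst y * v y) = ∫ y, (L ^ 2 + y ^ 2) * (((G.snd : W L) : ℝ → ℝ) y * v y)) :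
    (m + s) * ‖ιpairE hL P‖ ≤ ‖G‖ := by
  have hms : 0 < m + s := by linarith
  have hG := pair_gardingE h s t P G hweak
  obtain ⟨humR, -, h0R, -, -, -⟩ := profileE_facts hL P.fst
  obtain ⟨humI, -, h0I, -, -, -⟩ := profileE_facts hL P.snd
  have hgRm : AEStronglyMeasurable ((G.fst : W L) : ℝ → ℝ) volume := aestronglyMeasurable_of_W hL _
  have hgIm : AEStronglyMeasurable ((G.snd : W L) : ℝ → ℝ) volume := aestronglyMeasurable_of_W hL _
  obtain ⟨hiR, hbR⟩ := integral_weight_abs_mul_le (L := L) hgRm humR (weightedSq_of_W hL _) h0R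
  obtain ⟨hiI, hbI⟩ := integral_weight_abs_mul_le (L := L) hgIm humI (weightedSq_of_W hL _) h0I
  have habs : ∀ {f g : ℝ → ℝ}, Integrable (fun y => (L ^ 2 + y ^ 2) * |f y * g y|) →
      (∫ y, (L ^ 2 + y ^ 2) * (f y * g y)) ≤ ∫ y, (L ^ 2 + y ^ 2) * |f y * g y| := by
    intro f g hi
    refine (le_abs_self _).trans ?_
    calc |∫ y, (L ^ 2 + y ^ 2) * (f y * g y)| ≤ ∫ y, |(L ^ 2 + y ^ 2) * (f y * g y)| := by
          rw [← Real.norm_eq_abs]; exact (norm_integral_le_integral_norm _).trans (le_of_eq (by simp only [Real.norm_eq_abs]))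
      _ = ∫ y, (L ^ 2 + y ^ 2) * |f y * g y| := by
          refine integral_congr_ae (Eventually.of_forall fun y => ?_)
          show |(L ^ 2 + y ^ 2) * (f y * g y)| = (L ^ 2 + y ^ 2) * |f y * g y|
          rw [abs_mul, abs_of_nonneg (by positivity : (0:ℝ) ≤ L ^ 2 + y ^ 2)]
  have e1 := (habs hiR).trans hbR
  have e2 := (habs hiI).trans hbI
  rw [← norm_W] at e1
  rw [← norm_W] at e2
  set xR := Real.sqrt (∫ y, (L ^ 2 + y ^ 2) * profile P.fst y ^ 2) with hxR
  set xI := Real.sqrt (∫ y, (L ^ 2 + y ^ 2) * profile P.snd y ^ 2) with hxI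
  have h0R' : 0 ≤ ∫ y, (L ^ 2 + y ^ 2) * profile P.fst y ^ 2 := integral_nonneg fun y => by positivity
  have h0I' : 0 ≤ ∫ y, (L ^ 2 + y ^ 2) * profile P.snd y ^ 2 := integral_nonneg fun y => by positivity
  obtain ⟨hsq, -⟩ := norm_ιpairE hL P
  -- `X² = xR² + xI²`, `‖G‖² = ‖g_R‖² + ‖g_I‖²`
  have hX : ‖ιpairE hL P‖ = Real.sqrt (xR ^ 2 + xI ^ 2) := by
    rw [hxR, hxI, Real.sq_sqrt h0R', Real.sq_sqrt h0I', ← hsq, Real.sqrt_sq (norm_nonneg _)]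
  have hGn : ‖G‖ = Real.sqrt (‖(G.fst : W L)‖ ^ 2 + ‖(G.snd : W L)‖ ^ 2) := by
    rw [← WithLp.prod_norm_sq_eq_of_L2, Real.sqrt_sq (norm_nonneg _)]
  have hcs : ‖(G.fst : W L)‖ * xR + ‖(G.snd : W L)‖ * xI ≤ ‖G‖ * ‖ιpairE hL P‖ := by
    rw [hX, hGn]
    have := sqrt_mul_add_sqrt_mul_le (sq_nonneg ‖(G.fst : W L)‖) (sq_nonneg ‖(G.snd : W L)‖) (sq_nonneg xR) (sq_nonneg xI)
    rwa [Real.sqrt_sq (norm_nonneg _), Real.sqrt_sq (norm_nonneg _), Real.sqrt_sq (Real.sqrt_nonneg _),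
      Real.sqrt_sq (Real.sqrt_nonneg _)] at this
  have hcnn : 0 ≤ c * ((∫ y, (L ^ 2 + y ^ 2) * derE P.fst y ^ 2) + ∫ y, (L ^ 2 + y ^ 2) * derE P.snd y ^ 2) :=
    mul_nonneg h.c_pos.le (add_nonneg (integral_nonneg fun y => by positivity) (integral_nonneg fun y => by positivity))
  have hmain : (m + s) * ‖ιpairE hL P‖ ^ 2 ≤ ‖G‖ * ‖ιpairE hL P‖ := by
    rw [hsq]; linarith
  rcases (norm_nonneg (ιpairE hL P)).eq_or_lt with hz | hpos
  · rw [← hz, mul_zero]; exact norm_nonneg _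
  · have : (m + s) * ‖ιpairE hL P‖ * ‖ιpairE hL P‖ ≤ ‖G‖ * ‖ιpairE hL P‖ := by rw [mul_assoc, ← sq]; exact hmain
    exact le_of_mul_le_mul_right this hpos

end Pair

end SheetREvenPairUniqueness
end Summit.NavierStokesRegularity.OSWSelfSimilar

end
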